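/-
Copyright (c) 2026. All rights reserved.
Released under Apache 2.0 license as described in the file LICENSE.
-/
import Literature.Probability.LatticeModels.TouchBound
import Literature.Probability.LatticeModels.PlusMinusStateGibbs
import Literature.Probability.LatticeModels.SpinPercolationDichotomy
import Literature.Probability.LatticeModels.CoexistenceAnchoring
import HarnessLib

/-!
# The pinning probabilities are bounded below (Georgii–Higuchi 2000, Lemma 5.2, "`≥ θ/4`")

Georgii–Higuchi, J. Math. Phys. 41 (2000), Lemma 5.2: "`μ(x is +∗connected in (Δ ∪ ℓ_left)ᶜ to
I^{+∗}_up) ≥ θ/4` provided `x` lies sufficiently far to the right", where `θ > 0` is the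
`+∗`percolation probability of a point (positive above `β_c`, uniformly in the point by translation
invariance of the plus state). This file assembles the quantitative pinning bounds in the form
consumed by `GoodAboveFromPinning.le_measureReal_goodAboveW_of_pinning`:

* `plusPercProb β` — the `+`percolation probability of the origin under the plus state `μ⁺_β`
  (`exists_plusMeasure`), positive for `β > β_c(2)` (`plusPercProb_pos`, from `μ⁺(E⁺) = 1`,
  `measure_existsInfCluster_one_eq_one_of_spinCorr_eq_plusCorr`) and a lower bound for the
  `+∗`percolation probability of every site (`exists_state_plusPercProb_le`, translation invariance);
* `exists_pinLeft_ge` — for `μ' ∈ 𝒢(β, 0)`, `β > β_c(2)`, under which the infinite `+∗`cluster of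
  `π_up` touches the axis outside every box on the left and an infinite `-`cluster of `π_up`
  exists: `μ'(PinLeft m x) ≥ θ₀/8` for all axis sites `x` far enough to the left
  (`θ₀ = plusPercProb β`; the chain `measureReal_leftAnchored_ge` → `measureReal_semiLeft_eventually_ge`
  → `measureReal_pinLeft_ge` of `PinningLemma`, with `ae_leftAnchoredInf`);
* `ae_leftAnchoredInf_neg_of_plusStar_right`, `exists_pinLeft_neg_ge`, `exists_pinRightPlus_ge` (with the
  tree's `ae_leftAnchoredInf_refl0`) — the same two bounds in the orientation "`+`face on the right" (pin `x`
  on the left by `-`sites, `y` on the right by `+`sites);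
* `ae_leftAnchoredInf_negRefl_of_plusStar_left`, `exists_pinRightMinus_ge` — the mirror statement for
  `PinRightMinus` (pinning of `y` on the right by `-`sites) under the *same* hypotheses on `μ`: the
  infinite `-`cluster of `π_up` touches the axis outside every box on the right of the `+∗`cluster
  (sides lemma), so the flip-reflected measure `μ ∘ (ω ↦ -ω ∘ R₀)⁻¹ ∈ 𝒢(β, 0)` is anchored
  (`leftAnchoredInf_of_cluster` for the lattice cluster).

## References

* H.-O. Georgii, Y. Higuchi, J. Math. Phys. 41 (2000) 1153–1169, Lemma 5.2 [GeorgiiHiguchi2000].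
-/

namespace Literature.Probability.LatticeModels

open MeasureTheory SimpleGraph Percolation Filter

noncomputable section

variable {β : ℝ} {μ : Measure (SpinConfig (Site 2))}

/-! ### The percolation probability of a point under the plus state -/

section Theta

/-- `θ₀(β)`: the probability, under the plus state `μ⁺_β` (`h = 0`), that the origin lies in an
infinite `+`cluster; `0` for `β < 0`. [cite: GeorgiiHiguchi2000, §5 (the constant `θ` of Lemma 2.3 / Lemma 5.2)] -/
def plusPercProb (β : ℝ) : ℝ :=
  if h : 0 ≤ β then (Classical.choose (exists_plusMeasure_holds (d := 2) (β := β) (h := 0) h)).real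
    {ω | (siteCluster (zdGraph 2) (spinSites 1 ω) 0).Infinite} else 0

/-- Transport of the point percolation event along a shift. [folklore] -/
theorem infinite_siteCluster_configShift_iff (G : SimpleGraph (Site 2)) (φ : G ≃g G) (v : Site 2)
    (hφ : ∀ z, φ z = z + v) (ω : SpinConfig (Site 2)) (x : Site 2) :
    (siteCluster G (spinSites 1 (configShift v ω)) (x + v)).Infinite ↔ (siteCluster G (spinSites 1 ω) x).Infinite := by
  have hcfg : (configShift (S := ℤˣ) v ω : SpinConfig (Site 2)) = configRelabel φ.toEquiv ω := by
    funext y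
    rw [configShift_apply, configRelabel_apply]
    congr 1
    apply φ.injective
    rw [show φ (φ.toEquiv.symm y) = y from φ.toEquiv.apply_symm_apply y, hφ, sub_add_cancel]
  have key : siteCluster G ((φ : Site 2 → Site 2) '' spinSites 1 ω) (φ x) = (φ : Site 2 → Site 2) '' siteCluster G (spinSites 1 ω) x := by
    have h := siteCluster_relabel φ (spinSites 1 ω) x
    rwa [SiteConfig.relabel_apply] at h
  rw [hcfg, spinSites_configRelabel, show x + v = φ x by rw [hφ]]
  erw [key]
  exact ⟨Set.Infinite.of_image _, fun h => h.image φ.injective.injOn⟩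

/-- **`θ₀(β) > 0` above `β_c`** and it bounds the `+∗`percolation probability of every site under
some Gibbs measure (the plus state: `μ⁺(E⁺) = 1` and translation invariance). [cite: GeorgiiHiguchi2000, §5 (θ > 0 for β > β_c)] -/
theorem exists_state_plusPercProb_le (hβc : criticalBeta 2 < β) :
    0 < plusPercProb β ∧ ∃ μp ∈ isingGibbsMeasures 2 β 0,
      ∀ x : Site 2, plusPercProb β ≤ μp.real {ω | (siteCluster zdStarGraph (spinSites 1 ω) x).Infinite} := by
  have hβ : 0 ≤ β := (criticalBeta_nonneg 2).trans hβc.le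
  have hspec := Classical.choose_spec (exists_plusMeasure_holds (d := 2) (β := β) (h := 0) hβ)
  set μp := Classical.choose (exists_plusMeasure_holds (d := 2) (β := β) (h := 0) hβ) with hμp
  obtain ⟨hμpG, hinv, hcorr⟩ := hspec
  have hμpGG : IsGibbsMeasure (isingSpecification (zdGraph 2) β 0) μp := hμpG
  haveI := hμpGG.isProbabilityMeasure
  have hθ : plusPercProb β = μp.real {ω | (siteCluster (zdGraph 2) (spinSites 1 ω) 0).Infinite} := by
    rw [plusPercProb, dif_pos hβ]
  -- translation invariance: every site has the same `+`percolation probability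
  have hmeas : ∀ x : Site 2, MeasurableSet {ω : SpinConfig (Site 2) | (siteCluster (zdGraph 2) (spinSites 1 ω) x).Infinite} :=
    fun x => measurable_spinSites 1 (measurableSet_sitePercolatesAt (G := zdGraph 2) x)
  have hshift : ∀ x : Site 2, μp {ω | (siteCluster (zdGraph 2) (spinSites 1 ω) x).Infinite} =
      μp {ω | (siteCluster (zdGraph 2) (spinSites 1 ω) 0).Infinite} := by
    intro x
    conv_lhs => rw [← hinv x]
    rw [Measure.map_apply (configShift x).measurable (hmeas x)]
    congr 1
    ext ω
    simp only [Set.mem_preimage, Set.mem_setOf_eq]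
    have h := infinite_siteCluster_configShift_iff (zdGraph 2) (zdShiftIso x) x (fun z => rfl) ω 0
    rwa [zero_add] at h
  -- positivity
  have hpos : 0 < μp.real {ω | (siteCluster (zdGraph 2) (spinSites 1 ω) 0).Infinite} := by
    have h1 := measure_existsInfCluster_one_eq_one_of_spinCorr_eq_plusCorr (d := 2) le_rfl hβc hμpG hcorr
    have hcov : existsInfCluster (zdGraph 2) 1 ⊆ ⋃ x : Site 2, {ω : SpinConfig (Site 2) | (siteCluster (zdGraph 2) (spinSites 1 ω) x).Infinite} :=
      fun ω ⟨x, hx⟩ => Set.mem_iUnion.2 ⟨x, hx⟩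
    have hne : μp {ω | (siteCluster (zdGraph 2) (spinSites 1 ω) 0).Infinite} ≠ 0 := by
      intro h0
      have hall : μp (⋃ x : Site 2, {ω : SpinConfig (Site 2) | (siteCluster (zdGraph 2) (spinSites 1 ω) x).Infinite}) = 0 :=
        measure_iUnion_null fun x => by rw [hshift x]; exact h0
      have := measure_mono_null hcov hall
      rw [h1] at this
      exact one_ne_zero this
    exact ENNReal.toReal_pos hne (measure_ne_top _ _)
  refine ⟨hθ ▸ hpos, μp, hμpG, fun x => ?_⟩
  rw [hθ, measureReal_def, ← hshift x, ← measureReal_def]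
  exact measureReal_mono fun ω hω => hω.mono (siteCluster_zd_subset_star _ x)

/-- `θ₀(β) > 0` for `β > β_c(2)`. [cite: GeorgiiHiguchi2000, §5] -/
theorem plusPercProb_pos (hβc : criticalBeta 2 < β) : 0 < plusPercProb β :=
  (exists_state_plusPercProb_le hβc).1

end Theta

/-! ### The left pinning bound -/

section Left

/-- **The pinning probability on the left is at least `θ₀/8` when anchoring is almost sure**
(Georgii–Higuchi 2000, Lemma 5.2, mirror image, for `β > β_c(2)` and `μ' ∈ 𝒢(β, 0)` with
`LeftAnchoredInf m` almost surely): `θ₀(β)/8 ≤ μ'(PinLeft m x)` for all axis sites `x` far to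
the left (anchoring `≥ 3/4` by `measureReal_leftAnchored_ge`, semicircuit `≥ 1/2` for a large
`L` by `measureReal_semiLeft_eventually_ge`, then `measureReal_pinLeft_ge` with the plus state
as the auxiliary measure). [cite: GeorgiiHiguchi2000, Lemma 5.2] -/
theorem exists_pinLeft_ge_of_ae_anchored (hβc : criticalBeta 2 < β) {μ' : Measure (SpinConfig (Site 2))}
    (hμ' : μ' ∈ isingGibbsMeasures 2 β 0) (m : ℕ) (h : ∀ᵐ ω ∂μ', LeftAnchoredInf m ω) :
    ∃ N₀ : ℕ, ∀ x : Site 2, x 1 = 0 → x 0 ≤ -(N₀ : ℤ) → plusPercProb β / 8 ≤ μ'.real {ω | PinLeft m x ω} := by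
  have hβ : 0 ≤ β := (criticalBeta_nonneg 2).trans hβc.le
  have hμ'G : IsGibbsMeasure (isingSpecification (zdGraph 2) β 0) μ' := hμ'
  haveI := hμ'G.isProbabilityMeasure
  obtain ⟨hθpos, μp, hμpG, hθle⟩ := exists_state_plusPercProb_le hβc
  -- anchoring is almost sure
  have hanch : μ'.real {ω | LeftAnchoredInf m ω} = 1 := by
    rw [measureReal_def, show μ' {ω | LeftAnchoredInf m ω} = 1 from ?_, ENNReal.toReal_one]
    rw [← prob_compl_eq_zero_iff measurableSet_leftAnchoredInf, ← ae_iff.1 h]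
    rfl
  obtain ⟨N₁, hN₁⟩ := measureReal_leftAnchored_ge (μ := μ') hμ' m (ε := 1 / 4) (by norm_num)
  refine ⟨N₁ + m + 1, fun x hx1 hx0 => ?_⟩
  have hxN₁ : x 0 ≤ -(N₁ : ℤ) := by push_cast at hx0; omega
  have hxm : x 0 < -(m : ℤ) := by push_cast at hx0; omega
  have hA : 3 / 4 ≤ μ'.real {ω | LeftAnchored m x ω} := by have := hN₁ x hxN₁; rw [hanch] at this; linarith
  obtain ⟨L, hL⟩ := measureReal_semiLeft_eventually_ge (μ := μ') hμ' m x (ε := 1 / 4) (by norm_num)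
  have hS : 1 / 2 ≤ μ'.real {ω | SemiLeft m L x ω} := by have := hL L le_rfl; linarith
  have hP := measureReal_pinLeft_ge hβ hμ' hμpG m L hx1 hxm
  have hθx := hθle x
  have h1 : plusPercProb β / 2 * (1 / 2) ≤
      μp.real {ω | (siteCluster zdStarGraph (spinSites 1 ω) x).Infinite} / 2 * μ'.real {ω | SemiLeft m L x ω} :=
    mul_le_mul (by linarith) hS (by norm_num) (by linarith [hθpos])
  linarith

/-- **The pinning probability on the left is at least `θ₀/8`** (Georgii–Higuchi 2000, Lemma 5.2,
mirror image): for `β > β_c(2)` and `μ' ∈ 𝒢(β, 0)` under which the infinite `+∗`cluster of `π_up`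
touches the axis outside every box on the left and an infinite `-`cluster of `π_up` exists, every
axis site `x` far enough to the left satisfies `θ₀(β)/8 ≤ μ'(PinLeft m x)`. [cite: GeorgiiHiguchi2000, Lemma 5.2] -/
theorem exists_pinLeft_ge (hβc : criticalBeta 2 < β) {μ' : Measure (SpinConfig (Site 2))}
    (hμ' : μ' ∈ isingGibbsMeasures 2 β 0) (m : ℕ)
    (hL : ∀ᵐ ω ∂μ', ∃ x, ∀ n : ℕ, ∃ k : ℤ, k < -(n : ℤ) ∧
      (![k, 0] : Site 2) ∈ siteCluster zdStarGraph (spinSites 1 ω ∩ halfPlane 0) x)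
    (hC : ∀ᵐ ω ∂μ', ∃ y, (siteCluster (zdGraph 2) (spinSites (-1) ω ∩ halfPlane 0) y).Infinite) :
    ∃ N₀ : ℕ, ∀ x : Site 2, x 1 = 0 → x 0 ≤ -(N₀ : ℤ) → plusPercProb β / 8 ≤ μ'.real {ω | PinLeft m x ω} :=
  exists_pinLeft_ge_of_ae_anchored hβc hμ' m (ae_leftAnchoredInf hβc hμ' m hL hC)

end Left

/-! ### The right pinning bound (flip-reflection) -/

section Right

/-- `negRefl` as flip after relabelling. [folklore] -/
theorem negRefl_eq_neg_configRelabel :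
    negRefl = (fun σ : SpinConfig (Site 2) => -σ) ∘ configRelabel (reflectCoord (d := 2) 0).toEquiv := by
  funext ω; funext z
  simp only [negRefl_apply, Function.comp_apply, Pi.neg_apply, configRelabel_apply, reflectCoord_symm_apply]

/-- The flip-reflected measure is a Gibbs measure. [cite: GeorgiiHiguchi2000, §2 (flip-reflection symmetry)] -/
theorem map_negRefl_mem_isingGibbsMeasures (hμ : μ ∈ isingGibbsMeasures 2 β 0) : μ.map negRefl ∈ isingGibbsMeasures 2 β 0 := by
  have hμG : IsGibbsMeasure (isingSpecification (zdGraph 2) β 0) μ := hμ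
  rw [negRefl_eq_neg_configRelabel, ← Measure.map_map measurable_neg (configRelabel _).measurable]
  exact isGibbsMeasure_map_neg (zdGraph 2) β (IsGibbsMeasure.map_configRelabel _ (reflectCoord 0) hμG)

/-- Transport of half-plane clusters along the flip-reflection. [folklore] -/
theorem infinite_siteCluster_negRefl_iff {G : SimpleGraph (Site 2)} (φ : G ≃g G)
    (hφ : ∀ z : Site 2, φ z = reflectCoord 0 z) (s : ℤˣ) (ω : SpinConfig (Site 2)) (z : Site 2) :
    (siteCluster G (spinSites s (negRefl ω) ∩ halfPlane 0) (reflectCoord 0 z)).Infinite ↔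
      (siteCluster G (spinSites (-s) ω ∩ halfPlane 0) z).Infinite := by
  have hφ' : (reflectCoord (d := 2) 0).toEquiv = φ.toEquiv := by
    ext x : 1; exact (hφ x).symm
  rw [negRefl_eq_neg_configRelabel, Function.comp_apply, spinSites_neg_config, hφ', ← hφ z]
  exact infinite_siteCluster_configRelabel_iff φ (fun w => by rw [hφ]; exact (reflectCoord_zero_apply w).2) (-s) ω z

/-- Transport of "an axis site lies in the cluster" along the flip-reflection. [folklore] -/
theorem mem_siteCluster_negRefl_iff (ω : SpinConfig (Site 2)) (x : Site 2) (k : ℤ) :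
    (![k, 0] : Site 2) ∈ siteCluster zdStarGraph (spinSites 1 (negRefl ω) ∩ halfPlane 0) x ↔
      (![-k, 0] : Site 2) ∈ siteCluster zdStarGraph (spinSites (-1) ω ∩ halfPlane 0) (reflectCoord 0 x) := by
  rw [negRefl_eq_neg_configRelabel, Function.comp_apply, spinSites_neg_config]
  -- now a statement about `configRelabel`, colour `-1`
  set φ := starReflectZeroIso with hφdef
  have hφ1 : ∀ z : Site 2, (φ z) 1 = z 1 := fun z => (reflectCoord_zero_apply z).2
  have hO : spinSites (-1) (configRelabel (reflectCoord (d := 2) 0).toEquiv ω) ∩ halfPlane 0 =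
      (φ : Site 2 → Site 2) '' (spinSites (-1) ω ∩ halfPlane 0) := by
    rw [show (reflectCoord (d := 2) 0).toEquiv = φ.toEquiv from rfl, spinSites_configRelabel,
      image_reflectZero_inter_halfPlane φ hφ1]; rfl
  have key : siteCluster zdStarGraph ((φ : Site 2 → Site 2) '' (spinSites (-1) ω ∩ halfPlane 0)) (φ (reflectCoord 0 x)) =
      (φ : Site 2 → Site 2) '' siteCluster zdStarGraph (spinSites (-1) ω ∩ halfPlane 0) (reflectCoord 0 x) := by
    have h := siteCluster_relabel φ (spinSites (-1) ω ∩ halfPlane 0) (reflectCoord 0 x)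
    rwa [SiteConfig.relabel_apply] at h
  have hx : x = φ (reflectCoord 0 x) := (reflectCoord_reflectCoord 0 x).symm
  rw [← hx] at key
  rw [hO, key]
  constructor
  · rintro ⟨y, hy, hyk⟩
    have : y = ![-k, 0] := by
      have h2 := congrArg (reflectCoord (d := 2) 0) hyk
      rw [show reflectCoord 0 (φ y) = y from reflectCoord_reflectCoord 0 y] at h2
      rw [h2]; ext i; fin_cases i <;> simp [reflectCoord_apply]
    rw [← this]; exact hy
  · intro h
    refine ⟨![-k, 0], h, ?_⟩
    show reflectCoord 0 ![-k, 0] = ![k, 0]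
    ext i; fin_cases i <;> simp [reflectCoord_apply]

/-- Transport of "an axis site lies in the lattice cluster" along the flip-reflection. [folklore] -/
theorem mem_zdCluster_negRefl_iff (ω : SpinConfig (Site 2)) (x : Site 2) (k : ℤ) :
    (![k, 0] : Site 2) ∈ siteCluster (zdGraph 2) (spinSites 1 (negRefl ω) ∩ halfPlane 0) x ↔
      (![-k, 0] : Site 2) ∈ siteCluster (zdGraph 2) (spinSites (-1) ω ∩ halfPlane 0) (reflectCoord 0 x) := by
  rw [negRefl_eq_neg_configRelabel, Function.comp_apply, spinSites_neg_config]
  set φ := reflectCoord (d := 2) 0 with hφdef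
  have hφ1 : ∀ z : Site 2, (φ z) 1 = z 1 := fun z => (reflectCoord_zero_apply z).2
  have hO : spinSites (-1) (configRelabel φ.toEquiv ω) ∩ halfPlane 0 =
      (φ : Site 2 → Site 2) '' (spinSites (-1) ω ∩ halfPlane 0) := by
    rw [spinSites_configRelabel, image_reflectZero_inter_halfPlane φ hφ1]; rfl
  have key : siteCluster (zdGraph 2) ((φ : Site 2 → Site 2) '' (spinSites (-1) ω ∩ halfPlane 0)) (φ (reflectCoord 0 x)) =
      (φ : Site 2 → Site 2) '' siteCluster (zdGraph 2) (spinSites (-1) ω ∩ halfPlane 0) (reflectCoord 0 x) := by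
    have h := siteCluster_relabel φ (spinSites (-1) ω ∩ halfPlane 0) (reflectCoord 0 x)
    rwa [SiteConfig.relabel_apply] at h
  have hx : x = φ (reflectCoord 0 x) := (reflectCoord_reflectCoord 0 x).symm
  rw [← hx] at key
  rw [hO, key]
  constructor
  · rintro ⟨y, hy, hyk⟩
    have : y = ![-k, 0] := by
      have h2 := congrArg (reflectCoord (d := 2) 0) hyk
      rw [show reflectCoord 0 (φ y) = y from reflectCoord_reflectCoord 0 y] at h2
      rw [h2]; ext i; fin_cases i <;> simp [reflectCoord_apply]
    rw [← this]; exact hy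
  · intro h
    refine ⟨![-k, 0], h, ?_⟩
    show reflectCoord 0 ![-k, 0] = ![k, 0]
    ext i; fin_cases i <;> simp [reflectCoord_apply]

/-- **Anchoring of the `-`structure on the right, almost surely** (`β > β_c(2)`, `μ ∈ 𝒢(β, 0)`
under which the infinite `+∗`cluster of `π_up` touches the axis outside every box on the left and
an infinite `-`cluster of `π_up` exists): almost surely `LeftAnchoredInf m (negRefl ω)`. The
infinite `-`cluster of `π_up` touches the axis outside every box, and all its axis sites lie to the
right of those of the `+∗`cluster (sides lemma), so its reflected image is a one-sided touching
lattice cluster and `leftAnchoredInf_of_cluster` applies. [cite: GeorgiiHiguchi2000, Lemma 5.2 (hypothesis, mirror image) and Lemma 5.3 (proof, set-up)] -/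
theorem ae_leftAnchoredInf_negRefl_of_plusStar_left (hβc : criticalBeta 2 < β) (hμ : μ ∈ isingGibbsMeasures 2 β 0) (m : ℕ)
    (hL : ∀ᵐ ω ∂μ, ∃ x, ∀ n : ℕ, ∃ k : ℤ, k < -(n : ℤ) ∧
      (![k, 0] : Site 2) ∈ siteCluster zdStarGraph (spinSites 1 ω ∩ halfPlane 0) x)
    (hC : ∀ᵐ ω ∂μ, ∃ y, (siteCluster (zdGraph 2) (spinSites (-1) ω ∩ halfPlane 0) y).Infinite) :
    ∀ᵐ ω ∂μ, LeftAnchoredInf m (negRefl ω) := by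
  filter_upwards [hL, hC, ae_plusStar_minus_sides hβc hμ,
    ae_minus_touches_axis_io (G := zdGraph 2) hβc le_rfl zdGraph_le_zdStarGraph hμ] with ω hLω hCω hsides htouch
  obtain ⟨x₀, hx₀⟩ := hLω
  obtain ⟨y₀, hy₀⟩ := hCω
  have hDinf := infinite_of_axis_unbounded_below hx₀
  -- all axis sites of the `-`cluster lie right of those of the `+∗`cluster
  have hside : ∀ a k : ℤ, (![a, 0] : Site 2) ∈ siteCluster zdStarGraph (spinSites 1 ω ∩ halfPlane 0) x₀ →
      (![k, 0] : Site 2) ∈ siteCluster (zdGraph 2) (spinSites (-1) ω ∩ halfPlane 0) y₀ → a < k := by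
    rcases hsides x₀ y₀ hDinf hy₀ with h | h
    · exact h
    · exfalso
      obtain ⟨k₀, hk₀, -⟩ := exists_axis_far (htouch y₀ hy₀) 0
      obtain ⟨a, han, ha⟩ := hx₀ k₀.natAbs
      have := h a k₀ ha hk₀
      omega
  obtain ⟨a₀, -, ha₀⟩ := hx₀ 0
  -- the reflected `-`cluster, as a `+`cluster of `negRefl ω`
  refine leftAnchoredInf_of_cluster (G := zdGraph 2) zdGraph_le_zdStarGraph (x₀ := reflectCoord 0 y₀) (fun N => ?_)
    ⟨-a₀, fun t ht => ?_⟩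
  · obtain ⟨k, hk, hkN⟩ := exists_axis_far (htouch y₀ hy₀) (N + a₀.natAbs)
    have hka : a₀ < k := hside a₀ k ha₀ hk
    push_cast at hkN
    have hkpos : (N : ℤ) < k := by
      rcases abs_cases k with ⟨h2, _⟩ | ⟨h2, _⟩ <;> rcases abs_cases a₀ with ⟨h3, _⟩ | ⟨h3, _⟩ <;> omega
    refine ⟨-k, by omega, ?_⟩
    rw [← vec_eq_mkSite, mem_zdCluster_negRefl_iff, neg_neg, reflectCoord_reflectCoord]
    exact hk
  · rw [← vec_eq_mkSite, mem_zdCluster_negRefl_iff, reflectCoord_reflectCoord] at ht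
    have := hside a₀ (-t) ha₀ ht
    omega

/-- **The pinning probability on the right is at least `θ₀/8`** (Georgii–Higuchi 2000, Lemma 5.2
for the `-`spins on the right, "the same holds when 'left' and 'right' … are interchanged"): for
`β > β_c(2)` and `μ ∈ 𝒢(β, 0)` under which the infinite `+∗`cluster of `π_up` touches the axis
outside every box on the left and an infinite `-`cluster of `π_up` exists (the same hypotheses as
for the left pinning), every axis site `y` far enough to the right satisfies
`θ₀(β)/8 ≤ μ(PinRightMinus m y)`. [cite: GeorgiiHiguchi2000, Lemma 5.2] -/
theorem exists_pinRightMinus_ge (hβc : criticalBeta 2 < β) (hμ : μ ∈ isingGibbsMeasures 2 β 0) (m : ℕ)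
    (hL : ∀ᵐ ω ∂μ, ∃ x, ∀ n : ℕ, ∃ k : ℤ, k < -(n : ℤ) ∧
      (![k, 0] : Site 2) ∈ siteCluster zdStarGraph (spinSites 1 ω ∩ halfPlane 0) x)
    (hC : ∀ᵐ ω ∂μ, ∃ y, (siteCluster (zdGraph 2) (spinSites (-1) ω ∩ halfPlane 0) y).Infinite) :
    ∃ N₀ : ℕ, ∀ y : Site 2, y 1 = 0 → (N₀ : ℤ) ≤ y 0 → plusPercProb β / 8 ≤ μ.real {ω | PinRightMinus m y ω} := by
  have hμG : IsGibbsMeasure (isingSpecification (zdGraph 2) β 0) μ := hμ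
  haveI := hμG.isProbabilityMeasure
  set μ₂ := μ.map negRefl with hμ₂
  have hμ₂G : μ₂ ∈ isingGibbsMeasures 2 β 0 := map_negRefl_mem_isingGibbsMeasures hμ
  have hanch₂ : ∀ᵐ ω ∂μ₂, LeftAnchoredInf m ω := by
    rw [hμ₂, ae_map_iff measurable_negRefl.aemeasurable measurableSet_leftAnchoredInf]
    exact ae_leftAnchoredInf_negRefl_of_plusStar_left hβc hμ m hL hC
  obtain ⟨N₀, hN₀⟩ := exists_pinLeft_ge_of_ae_anchored hβc hμ₂G m hanch₂
  refine ⟨N₀, fun y hy1 hy0 => ?_⟩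
  have hc := reflectCoord_zero_apply y
  have h := hN₀ (reflectCoord 0 y) (by rw [hc.2, hy1]) (by rw [hc.1]; omega)
  rwa [hμ₂, measureReal_def, Measure.map_apply measurable_negRefl (measurableSet_pinLeft (m := m) _), ← measureReal_def] at h

end Right

/-! ### The mirror-image orientation (`+`face on the right) -/

section RightOrientation

/-- **Anchoring of the `-`structure on the left, almost surely, `+`face on the right**: for
`β > β_c(2)` and `μ ∈ 𝒢(β, 0)` under which the infinite `+∗`cluster of `π_up` touches the axis
outside every box on the right and an infinite `-`cluster of `π_up` exists, almost surely
`LeftAnchoredInf m (-ω)` (the `-`cluster touches the axis outside every box, left of the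
`+∗`cluster). [cite: GeorgiiHiguchi2000, Lemma 5.2 (hypothesis) and Lemma 5.3 (proof, set-up)] -/
theorem ae_leftAnchoredInf_neg_of_plusStar_right (hβc : criticalBeta 2 < β) (hμ : μ ∈ isingGibbsMeasures 2 β 0) (m : ℕ)
    (hR : ∀ᵐ ω ∂μ, ∃ x, ∀ n : ℕ, ∃ k : ℤ, (n : ℤ) < k ∧
      (![k, 0] : Site 2) ∈ siteCluster zdStarGraph (spinSites 1 ω ∩ halfPlane 0) x)
    (hC : ∀ᵐ ω ∂μ, ∃ y, (siteCluster (zdGraph 2) (spinSites (-1) ω ∩ halfPlane 0) y).Infinite) :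
    ∀ᵐ ω ∂μ, LeftAnchoredInf m (-ω) := by
  filter_upwards [hR, hC, ae_plusStar_minus_sides hβc hμ,
    ae_minus_touches_axis_io (G := zdGraph 2) hβc le_rfl zdGraph_le_zdStarGraph hμ] with ω hRω hCω hsides htouch
  obtain ⟨x₀, hx₀⟩ := hRω
  obtain ⟨y₀, hy₀⟩ := hCω
  have hDinf := infinite_of_axis_unbounded_above hx₀
  obtain ⟨k₀, hk₀, -⟩ := exists_axis_far (htouch y₀ hy₀) 0
  -- all axis sites of the `-`cluster lie left of those of the `+∗`cluster
  have hside : ∀ a k : ℤ, (![a, 0] : Site 2) ∈ siteCluster zdStarGraph (spinSites 1 ω ∩ halfPlane 0) x₀ →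
      (![k, 0] : Site 2) ∈ siteCluster (zdGraph 2) (spinSites (-1) ω ∩ halfPlane 0) y₀ → k < a := by
    rcases hsides x₀ y₀ hDinf hy₀ with h | h
    · exfalso
      obtain ⟨a, han, ha⟩ := hx₀ k₀.natAbs
      have := h a k₀ ha hk₀
      omega
    · exact h
  obtain ⟨a₀, -, ha₀⟩ := hx₀ 0
  have hset : spinSites 1 (-ω) ∩ halfPlane 0 = spinSites (-1) ω ∩ halfPlane 0 := by rw [spinSites_neg_config]
  refine leftAnchoredInf_of_cluster (G := zdGraph 2) zdGraph_le_zdStarGraph (x₀ := y₀) (fun N => ?_) ⟨a₀, fun t ht => ?_⟩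
  · obtain ⟨k, hk, hkN⟩ := exists_axis_far (htouch y₀ hy₀) (N + a₀.natAbs)
    have hka : k < a₀ := hside a₀ k ha₀ hk
    push_cast at hkN
    have hkneg : k < -(N : ℤ) := by
      rcases abs_cases k with ⟨h2, _⟩ | ⟨h2, _⟩ <;> rcases abs_cases a₀ with ⟨h3, _⟩ | ⟨h3, _⟩ <;> omega
    refine ⟨k, hkneg, ?_⟩
    rw [hset, ← vec_eq_mkSite]; exact hk
  · rw [hset, ← vec_eq_mkSite] at ht
    exact (hside a₀ t ha₀ ht).le

/-- **The pinning probability on the left by `-`sites is at least `θ₀/8`** (`+`face on the right):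
`θ₀(β)/8 ≤ μ(PinLeft m x (-·))` for all axis sites `x` far to the left. [cite: GeorgiiHiguchi2000, Lemma 5.2] -/
theorem exists_pinLeft_neg_ge (hβc : criticalBeta 2 < β) (hμ : μ ∈ isingGibbsMeasures 2 β 0) (m : ℕ)
    (hR : ∀ᵐ ω ∂μ, ∃ x, ∀ n : ℕ, ∃ k : ℤ, (n : ℤ) < k ∧
      (![k, 0] : Site 2) ∈ siteCluster zdStarGraph (spinSites 1 ω ∩ halfPlane 0) x)
    (hC : ∀ᵐ ω ∂μ, ∃ y, (siteCluster (zdGraph 2) (spinSites (-1) ω ∩ halfPlane 0) y).Infinite) :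
    ∃ N₀ : ℕ, ∀ x : Site 2, x 1 = 0 → x 0 ≤ -(N₀ : ℤ) → plusPercProb β / 8 ≤ μ.real {ω | PinLeft m x (-ω)} := by
  have hμG : IsGibbsMeasure (isingSpecification (zdGraph 2) β 0) μ := hμ
  haveI := hμG.isProbabilityMeasure
  set μ₃ := μ.map (fun σ : SpinConfig (Site 2) => -σ) with hμ₃
  have hμ₃G : μ₃ ∈ isingGibbsMeasures 2 β 0 := isGibbsMeasure_map_neg (zdGraph 2) β hμG
  have hanch : ∀ᵐ ω ∂μ₃, LeftAnchoredInf m ω := by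
    rw [hμ₃, ae_map_iff measurable_neg.aemeasurable measurableSet_leftAnchoredInf]
    exact ae_leftAnchoredInf_neg_of_plusStar_right hβc hμ m hR hC
  obtain ⟨N₀, hN₀⟩ := exists_pinLeft_ge_of_ae_anchored hβc hμ₃G m hanch
  refine ⟨N₀, fun x hx1 hx0 => ?_⟩
  have h := hN₀ x hx1 hx0
  rwa [hμ₃, measureReal_def, Measure.map_apply measurable_neg (measurableSet_pinLeft (m := m) _), ← measureReal_def] at h

/-- **The pinning probability on the right by `+`sites is at least `θ₀/8`** (`+`face on the
right): `θ₀(β)/8 ≤ μ'(PinRightPlus m y)` for all axis sites `y` far to the right. [cite: GeorgiiHiguchi2000, Lemma 5.2] -/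
theorem exists_pinRightPlus_ge (hβc : criticalBeta 2 < β) {μ' : Measure (SpinConfig (Site 2))}
    (hμ' : μ' ∈ isingGibbsMeasures 2 β 0) (m : ℕ)
    (hR : ∀ᵐ ω ∂μ', ∃ x, ∀ n : ℕ, ∃ k : ℤ, (n : ℤ) < k ∧
      (![k, 0] : Site 2) ∈ siteCluster zdStarGraph (spinSites 1 ω ∩ halfPlane 0) x)
    (hC : ∀ᵐ ω ∂μ', ∃ y, (siteCluster (zdGraph 2) (spinSites (-1) ω ∩ halfPlane 0) y).Infinite) :
    ∃ N₀ : ℕ, ∀ y : Site 2, y 1 = 0 → (N₀ : ℤ) ≤ y 0 → plusPercProb β / 8 ≤ μ'.real {ω | PinRightPlus m y ω} := by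
  have hμ'G : IsGibbsMeasure (isingSpecification (zdGraph 2) β 0) μ' := hμ'
  haveI := hμ'G.isProbabilityMeasure
  set μ₄ := μ'.map refl0 with hμ₄
  have hμ₄G : μ₄ ∈ isingGibbsMeasures 2 β 0 := IsGibbsMeasure.map_configRelabel _ (reflectCoord 0) hμ'G
  have hanch : ∀ᵐ ω ∂μ₄, LeftAnchoredInf m ω := by
    rw [hμ₄, ae_map_iff measurable_refl0.aemeasurable measurableSet_leftAnchoredInf]
    exact ae_leftAnchoredInf_refl0 hβc hμ' m hR hC
  obtain ⟨N₀, hN₀⟩ := exists_pinLeft_ge_of_ae_anchored hβc hμ₄G m hanch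
  refine ⟨N₀, fun y hy1 hy0 => ?_⟩
  have hc := reflectCoord_zero_apply y
  have h := hN₀ (reflectCoord 0 y) (by rw [hc.2, hy1]) (by rw [hc.1]; omega)
  rwa [hμ₄, measureReal_def, Measure.map_apply measurable_refl0 (measurableSet_pinLeft (m := m) _), ← measureReal_def] at h

end RightOrientation

end

end Literature.Probability.LatticeModels
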